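import Summits.Ventures.Crystal3D.Theorems.StickyWulffConstantCoaxialWallLawSeamFullCensusSound
import Summits.Ventures.Crystal3D.Theorems.StickyWulffConstantCoaxialWallLawSeamFullCensusCertData
import Summits.Ventures.Crystal3D.Theorems.StickyWulffConstantCoaxialWallLawSeamThreePayerSplit
import HarnessLib

/-!
# `SatCensus11Full` FROM E1: the deg-11 FULL-reader saturation census follows from `P5Exhaustion`, GAP(5/2) and the twin vacancy cap `VacancyCapTwin`
# (crux `CoaxialWallLaw`, stmt-Ventures-19481; lane F 'Certificates' v8.4, registered stub `stub_satCensus11Full : TailResidue.SatCensus11Full`)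

HONEST FRAMING. Venture `Summits/Ventures/Crystal3D` (cell `crystal3d-full`); helper for `stub_satCensus11Full`; head of the chain '…SeamFullCensusKit' → '…Checker' →
'…FreeBall' → '…VacLeaf' → '…Sound' → '…CertData'.  **`satCensus11Full_of_E1 : P5Exhaustion → KissingGap (5/2) → VacancyCapTwin → SatCensus11Full`.**
Proof = the kernel checks the certificate (`certFull_ok : run certFull initSt = true`, `decide +kernel`, standard axioms) + soundness (`run_sound`) + the initial
interpretation (reader `q` FULL ⇒ the twelve slot balls present and every contact of `q` among them) + the reduction of a general admissible class `(G, d = G sⱼ)` to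
`d = s₀` by a signed coordinate permutation of the model (`Msym`, reflections with rational normals, tables by `decide`).  CONTENT (seat 19481-p2 g15's finding):
E1 CASCADED to every saturated contact of the end ball that acquires a closed slot star closes the whole FULL-reader case except (i) one E1-silent state (four common
neighbours twinned on three `{111}` planes), settled by the elementary free-ball lemma, and (ii) the coherent-twin-boundary leaf «twin dozen of `b` minus one mirror»,
settled by the twin vacancy census — so NO generic free-ball cap row (memo F-TAIL-g14's C3) and NO fcc vacancy cap is needed; `KissingGap (5/2)` is the tree theorem
`kissingGap_250`, so the stub is DERIVABLE as `satCensus11Full_of_E1 stub_E1 stub_gap stub_vacancyCapTwin` once `VacancyCapTwin` (certificate-shaped, cf-p2 C2) is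
registered.
WHAT THIS IS NOT: `P5Exhaustion` and `VacancyCapTwin` remain named inputs; the NARROW/GLIDE/CROSS pieces are untouched; F-C1 not moved.
-/

noncomputable section

namespace Summit.Ventures.Crystal3D.Theorems

namespace TailResidue

namespace FullCensus

open Summit.Ventures.Crystal3D Finset EndRowFloor NearIdentity
open scoped InnerProductSpace

/-! ### §1 The kernel checks the certificate -/

/-- **The certificate is accepted by the checker** (kernel evaluation, ≈ 25 s). -/
theorem certFull_ok : run certFull initSt = true := by
  decide +kernel

/-- The empty chain has the base tables. -/
theorem tabs_nil : tabs [] = tabBase := rfl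

attribute [local irreducible] insertV addAll fullList ownList mirList farList tabs

variable {X : Finset (EuclideanSpace ℝ (Fin 3))} {G' : EuclideanSpace ℝ (Fin 3) ≃ₗᵢ[ℝ] EuclideanSpace ℝ (Fin 3)} {q₀ : EuclideanSpace ℝ (Fin 3)}

/-! ### §2 The initial state -/

/-- The model origin reads the reader `q₀`. -/
theorem TT_origin : TT G' q₀ ⟨0, 0, 0⟩ = q₀ := by
  have h0 : Q3.toV ⟨0, 0, 0⟩ = 0 := by ext i; fin_cases i <;> simp [Q3.toV]
  have hi : iptQ (0 : Fin 3 → ℚ) = 0 := by ext i; simp [iptQ_apply]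
  rw [TT, h0, T, PQ, hi, map_zero, map_zero, add_zero]

/-- The end ball's model point is the slot ball `3·slot 0` of the base frame. -/
theorem bQ_toV : bQ.toV = gBase 0 := by
  ext j; fin_cases j <;> simp [bQ, Q3.toV, gBase, castQ, slot3, slotInt]

/-- Table: the twelve slot balls of the reader are distinct model contacts of it. -/
theorem init_table : ((List.finRange 12).map fun i : Fin 12 => Q3.add ⟨0, 0, 0⟩ (gOf tabBase i)).Nodup ∧
    ∀ i : Fin 12, Q3.d2 ⟨0, 0, 0⟩ (Q3.add ⟨0, 0, 0⟩ (gOf tabBase i)) = 18 := by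
  decide +kernel

open scoped Classical in
/-- **The initial state is interpreted**: reader `q₀ ∈ X` with its twelve base-frame slot balls in `X` (kissing bound ⇒ these are all its contacts). -/
theorem inv_initSt (hX : ∀ p ∈ X, ∀ p' ∈ X, p ≠ p' → 1 ≤ dist p p') (hq0 : q₀ ∈ X) (hslots : ∀ i : Fin 12, T G' q₀ (gBase i) ∈ X) : Inv X G' q₀ initSt := by
  have h0 : Q3.toV ⟨0, 0, 0⟩ = 0 := by ext i; fin_cases i <;> simp [Q3.toV]
  have hslot' : ∀ i : Fin 12, TT G' q₀ (Q3.add ⟨0, 0, 0⟩ (gOf tabBase i)) ∈ X := by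
    intro i
    have e := TT_add_gOf (G' := G') (q₀ := q₀) [] ⟨0, 0, 0⟩ i
    rw [h0, zero_add, tabs_nil] at e
    rw [e]; exact hslots i
  -- the twelve slot balls are all the contacts of the reader
  obtain ⟨hnd, hd18⟩ := init_table
  set C := X.filter fun z => dist (TT G' q₀ ⟨0, 0, 0⟩) z = 1 with hC
  set I := (((List.finRange 12).map fun i : Fin 12 => Q3.add ⟨0, 0, 0⟩ (gOf tabBase i)).map (TT G' q₀)).toFinset with hI
  have hIC : I ⊆ C := by
    intro z hz
    rw [hI, List.mem_toFinset, List.mem_map] at hz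
    obtain ⟨a, ha, rfl⟩ := hz
    obtain ⟨i, -, rfl⟩ := List.mem_map.1 ha
    exact mem_filter.2 ⟨hslot' i, (dist_TT_eq_one_iff G' q₀ _ _).2 (hd18 i)⟩
  have hIcard : I.card = 12 := by
    rw [hI, List.card_toFinset, ((List.nodup_map_iff (TT_injective G' q₀)).2 hnd).dedup]; simp
  have hCle : C.card ≤ 12 := card_filter_dist_eq_one_le_twelve X hX _
  have hIeq : I = C := eq_of_subset_of_card_le hIC (by rw [hIcard]; exact hCle)
  have hC12 : C.card = 12 := by rw [← hIeq, hIcard]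
  have hq12 : TT G' q₀ ⟨0, 0, 0⟩ ∈ X ∧ (X.filter fun z => dist (TT G' q₀ ⟨0, 0, 0⟩) z = 1).card = 12 := ⟨by rw [TT_origin]; exact hq0, hC12⟩
  have hcont : ∀ z ∈ X, dist (TT G' q₀ ⟨0, 0, 0⟩) z = 1 → ∃ u ∈ fullList tabBase ⟨0, 0, 0⟩, z = TT G' q₀ u := by
    intro z hz hd
    have hzI : z ∈ I := by rw [hIeq]; exact mem_filter.2 ⟨hz, hd⟩
    rw [hI, List.mem_toFinset, List.mem_map] at hzI
    obtain ⟨a, ha, rfl⟩ := hzI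
    obtain ⟨i, -, rfl⟩ := List.mem_map.1 ha
    exact ⟨_, mem_fullList.2 ⟨i, rfl⟩, rfl⟩
  exact
    { pres := by
        intro a ha
        rcases mem_addAll.1 ha with ha | ha
        · rw [List.mem_singleton.1 ha, TT_origin]; exact hq0
        · obtain ⟨i, rfl⟩ := mem_fullList.1 ha; exact hslot' i
      nodup := nodup_addAll (List.nodup_singleton _)
      sat := by intro a ha; rw [List.mem_singleton.1 ha]; exact hq12
      dzn := by
        intro pd hpd
        rw [List.mem_singleton.1 hpd]
        exact ⟨hq12, hcont⟩
      emp := by intro a ha; simp [initSt] at ha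
      uns := by intro u hu; simp [initSt] at hu }

open scoped Classical in
/-- **THE ENGINE.**  Under E1, GAP(5/2) and `VacancyCapTwin`: a `1`-separated `X` containing the reader `q₀` with its twelve base-frame slot balls `T (gBase i)`, whose end
ball `T (gBase 0)` has exactly eleven contacts any two unsaturated ones of which coincide — is contradictory. -/
theorem engine (hX : ∀ p ∈ X, ∀ p' ∈ X, p ≠ p' → 1 ≤ dist p p') (hE1 : P5Exhaustion) (hg : KissingGap (5 / 2)) (hcap : VacancyCapTwin) (hq0 : q₀ ∈ X)
    (hslots : ∀ i : Fin 12, T G' q₀ (gBase i) ∈ X) (h11 : (X.filter fun z => dist (T G' q₀ (gBase 0)) z = 1).card = 11)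
    (hone : ∀ y ∈ X, ∀ y' ∈ X, dist (T G' q₀ (gBase 0)) y = 1 → dist (T G' q₀ (gBase 0)) y' = 1 →
      (X.filter fun z => dist y z = 1).card ≤ 11 → (X.filter fun z => dist y' z = 1).card ≤ 11 → y = y') : False := by
  have hb : TT G' q₀ bQ = T G' q₀ (gBase 0) := by rw [TT, bQ_toV]
  have hyp : Hyp X G' q₀ :=
    { sep := hX, e1 := hE1, gap := hg, cap := hcap, bmem := by rw [hb]; exact hslots 0, deg := by rw [hb]; exact h11, one := by rw [hb]; exact hone }
  exact run_sound hyp certFull initSt (inv_initSt hX hq0 hslots) certFull_ok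

/-! ### §3 Signed coordinate permutations of the model, and the census theorem -/

/-- The rational reflection across `n`: `v ↦ v − (2(n·v)/(n·n)) n`. -/
def reflV (n v : Fin 3 → ℚ) : Fin 3 → ℚ := v - (2 * dq n v / dq n n) • n

/-- A chain of rational reflections (first normal applied first). -/
def msym : List (Fin 3 → ℚ) → (Fin 3 → ℚ) → (Fin 3 → ℚ)
  | [], v => v
  | n :: ns, v => msym ns (reflV n v)

/-- The corresponding isometry of the model space. -/
def Msym : List (Fin 3 → ℚ) → (EuclideanSpace ℝ (Fin 3) ≃ₗᵢ[ℝ] EuclideanSpace ℝ (Fin 3))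
  | [] => LinearIsometryEquiv.refl ℝ _
  | n :: ns => ((ℝ ∙ iptQ n)ᗮ.reflection).trans (Msym ns)

/-- `Msym` acts on model points by `msym`. -/
theorem Msym_iptQ : ∀ (ns : List (Fin 3 → ℚ)), (∀ n ∈ ns, dq n n ≠ 0) → ∀ v : Fin 3 → ℚ, Msym ns (iptQ v) = iptQ (msym ns v) := by
  intro ns
  induction ns with
  | nil => intro _ v; rfl
  | cons n ns ih =>
    intro hns v
    show Msym ns ((ℝ ∙ iptQ n)ᗮ.reflection (iptQ v)) = iptQ (msym ns (reflV n v))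
    rw [reflection_iptQ _ _ (hns n (by simp)), ← ih (fun m hm => hns m (by simp [hm]))]
    rfl

/-- The reflection chains carrying slot `0 = (1,1,0)` to each of the twelve slots: coordinate sign changes `eₓ, e_y, e_z` and the swaps `y ↔ z`, `x ↔ z`. -/
def symNormals (j : Fin 12) : List (Fin 3 → ℚ) :=
  [[], [![0, 1, 0]], [![1, 0, 0]], [![1, 0, 0], ![0, 1, 0]], [![0, 1, -1]], [![0, 1, -1], ![0, 0, 1]], [![0, 1, -1], ![1, 0, 0]],
    [![0, 1, -1], ![1, 0, 0], ![0, 0, 1]], [![1, 0, -1]], [![1, 0, -1], ![0, 0, 1]], [![1, 0, -1], ![0, 1, 0]], [![1, 0, -1], ![0, 1, 0], ![0, 0, 1]]].getD j []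

/-- Table: the chains are non-degenerate, carry `3·slot 0` to `3·slot j`, and permute the twelve base slot images. -/
theorem sym_table : ∀ j : Fin 12, (∀ n ∈ symNormals j, dq n n ≠ 0) ∧ msym (symNormals j) (gBase 0) = gBase j ∧
    ∀ i : Fin 12, ∃ i' : Fin 12, msym (symNormals j) (gBase i) = gBase i' := by
  decide +kernel

/-- The base frame reads the base slot images: `L⁻¹ (PQ (3·slot k)) = slot k`. -/
theorem L_symm_PQ_gBase (k : Fin 12) : L.symm (PQ (gBase k)) = slotSite k := by
  have h : PQ (gBase k) = L (slotSite k) := by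
    show PQ (castQ (slot3 k)) = _
    rw [← P_eq_PQ, L_slotSite]; rfl
  rw [h, LinearIsometryEquiv.symm_apply_apply]

open scoped Classical in
/-- **`SatCensus11Full` FROM E1, GAP(5/2) AND THE TWIN VACANCY CAP.**  At a deg-11 (A)-end ball `b = q + d` of a FULL reader `q` (admissible slot class `(G, d)`), two distinct
contact-neighbours of `b` have at most eleven contacts.  (The two-payer clause, the predecessor, the non-moving clause and the word version are not used.) -/
theorem satCensus11Full_of_E1 (hE1 : P5Exhaustion) (hg : KissingGap (5 / 2)) (hcap : VacancyCapTwin) : SatCensus11Full := by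
  intro X hX _ S₁ S₂ h₁ h₂ b q G d hq _ _ hadm _ hfull hbq _ h11
  by_contra hcon
  obtain ⟨u, hu, rfl⟩ : ∃ w ∈ fccSlots, d = G w := by
    rcases hadm with h | h
    · exact (exists_slots_of_adm h₁ h).1
    · exact (exists_slots_of_adm h₂ h).1
  obtain ⟨j, rfl⟩ := exists_slotSite_eq hu
  obtain ⟨hns, h0, hperm⟩ := sym_table j
  set Ψ : EuclideanSpace ℝ (Fin 3) ≃ₗᵢ[ℝ] EuclideanSpace ℝ (Fin 3) := Qr.symm.trans ((Msym (symNormals j)).trans (Qr.trans L.symm)) with hΨ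
  set G₁ : EuclideanSpace ℝ (Fin 3) ≃ₗᵢ[ℝ] EuclideanSpace ℝ (Fin 3) := Ψ.trans G with hG₁
  have hT : ∀ w : Fin 3 → ℚ, T G₁ q w = q + G (L.symm (PQ (msym (symNormals j) w))) := by
    intro w
    simp only [T, hG₁, hΨ, LinearIsometryEquiv.trans_apply, PQ, LinearIsometryEquiv.symm_apply_apply, Msym_iptQ _ hns]
  have hslots : ∀ i : Fin 12, T G₁ q (gBase i) ∈ X := by
    intro i
    obtain ⟨i', hi'⟩ := hperm i
    rw [hT, hi', L_symm_PQ_gBase]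
    exact hfull _ (slotSite_mem i')
  have hbT : T G₁ q (gBase 0) = b := by rw [hT, h0, L_symm_PQ_gBase, hbq]
  refine engine (G' := G₁) hX hE1 hg hcap hq hslots (by rw [hbT]; exact h11) ?_
  intro y hy y' hy' hd hd' hc hc'
  rw [hbT] at hd hd'
  by_contra hne
  exact hcon ⟨y, hy, y', hy', hne, hd, hd', hc, hc'⟩

end FullCensus

end TailResidue

end Summit.Ventures.Crystal3D.Theorems

end
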